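import Summits.Ventures.Crystal3D.Kissing125.SearchCheck1
import HarnessLib

/-!
# The growth-search checker (computable part) — K25 copy at `κ = 7/32` (`h = 5/4`), part 2/3

HONEST FRAMING (cell pub-crystal3d, K-path at `h = 5/4`): this is NOT a result printed by Hales.  It is his
METHOD (arXiv:1209.6043, Theorem 3: the main estimate + the classification of the contact graphs of kissing
configurations, in the tree's form of a verified interval-arithmetic growth search, `Literature/…/KissingSearch*.lean`)
RE-RUN at the separation `5/2` instead of `2h₀ = 2.52` (largest long-side cosine `κ = 1 − (5/4)²/2 = 7/32` instead of
`κ₀ = 1031/5000`).  The declarations are namespace-shadowing COPIES of the tree's declarations (same names, inside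
`namespace Summit.Ventures.Crystal3D.Kissing125[.KissingSearch]`, original docstrings and citation tags kept — the tags
name the printed METHOD step each declaration implements); the diff to the originals is stated per file.  Generated by
`HOME/lean/kissing125/gen/mkfiles.py`; audit recipe in `HOME/lean/kissing125/README.md`.  Nothing here is asserted
about GAP(1.26) or any census.

THIS FILE: copy of `Literature/Geometry/DiscreteGeometry/KissingSearchCheck.lean` with EXACTLY ONE semantic change, `def κ0 : ℚ := 7 / 32` (was `1031 / 5000`); everything else (cells `K = 15`, `δ = 1/2048`, tables, rules, roots, parts) byte-identical up to the namespace line.  (Part 2 of 3: lines 315–644 of the transformed copy; the split is only for the 400-line rule.)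

## References
* T. C. Hales, *A proof of Fejes Tóth's conjecture on sphere packings with kissing number twelve*,
  arXiv:1209.6043 (2012): Definition 1, Theorem 2 (main estimate `d₃`), Theorem 3, Lemmas 7–10. [`Hales2012`]
* R. E. Moore, *Interval Analysis* (1966), Theorem 3.1, §4.4. [`Moore1966`]
-/

namespace Summit.Ventures.Crystal3D.Kissing125
open Literature.Geometry.DiscreteGeometry

namespace KissingSearch
open Literature.Analysis.ValidatedNumerics KissingLP

/-- Window trimming of the slots at a closed label `v` (triangles `tv` at `v`), given the sums
`sl, sh` of the lower / upper ends of the slot brackets at `v` in `s` (brackets of `s` are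
valid for every narrowing of `s`, so the windows computed from them stay sound while the state
is trimmed). [folklore] -/
def St.trimAt (s : St) (v sl sh : ℕ) (tv : List ℕ) : Option St :=
  tv.foldl (fun os t =>
    match os with
    | none => none
    | some s1 =>
      let br := s.slotBr t v
      if br = NOBR then none
      else
        let wlo := TWOPI_LO - (sh - brHi br)
        let whi := TWOPI_HI - (sl - brLo br)
        match s1.trimSide t v 0 wlo whi with
        | none => none
        | some s2 => match s2.trimSide t v 1 wlo whi with
          | none => none
          | some s3 => s3.trimSide t v 2 wlo whi) (some s)

/-- **The node rule at `v`**: nothing if `v` has no triangle; kill on an inconsistent link or an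
infeasible slot; at a CLOSED label (every side at `v` in `0` or `2` placed triangles: under the
single-cycle link axiom all triangles at `v` are then placed) require `Σ lo < 12868`,
`12867 ≤ Σ hi` and trim the windows; at an open one require `Σ lo + THMIN < 12868`.
[cite: Hales2012, proof of Lemma 9 (node equations)] -/
def St.nodeRule (s : St) (v : ℕ) : Option St :=
  let (nv, ne, bad, verts) := s.linkSummary v
  if nv = 0 then some s
  else if s.badLink v verts bad then none
  else
    let tv := s.trisAt v
    match s.slotSums v tv with
    | none => none
    | some (sl, sh) =>
      if ne = 0 then
        (if TWOPI_HI ≤ sl ∨ sh < TWOPI_LO then none else s.trimAt v sl sh tv)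
      else if TWOPI_HI ≤ sl + THMIN then none
      else some s

/-- Feasibility trimming of the three sides of every placed triangle at `v`. [folklore] -/
def St.trimTrisAt (s : St) (v : ℕ) : Option St :=
  (s.trisAt v).foldl (fun os t =>
    match os with
    | none => none
    | some s =>
      match s.trimSide t (tv0 t) 0 0 NLAD with
      | none => none
      | some s => match s.trimSide t (tv0 t) 1 0 NLAD with
        | none => none
        | some s => s.trimSide t (tv0 t) 2 0 NLAD) (some s)

/-- The pairing rule on one side `{a, b}`. [cite: Hales2012, proof of Theorem 2] -/
def St.pairRuleAt (s : St) (a b : ℕ) : Option St :=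
  let r := s.gdom a b
  if r = 0 ∨ r = UNL ∨ s.gsc a b ≠ 2 then some s
  else
    let ap := s.apexes a b
    if ap.length = 2 ∧ ap.all fun w => s.gdom w a == 0 && s.gdom w b == 0 then
      let lo := max (rLo r) ZCELL
      if rHi r < lo then none
      else if lo = rLo r then some s else some (s.sdom a b (mkR lo (rHi r)))
    else some s

/-- The pairing rule on all sides at `v`. [folklore] -/
def St.pairRulesAt (s : St) (v : ℕ) : Option St :=
  foldRange (fun os u => match os with
    | none => none
    | some s => if u = v then some s else s.pairRuleAt u v) 0 12 (some s)

/-- The local propagation step at `v`: triangle trims at `v`, pairing at `v`, node rule at `v`.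
[folklore] -/
def St.localStep (s : St) (v : ℕ) : Option St :=
  match s.trimTrisAt v with
  | none => none
  | some s => match s.pairRulesAt v with
    | none => none
    | some s => s.nodeRule v

/-- The labels whose rules depend on the side `i` (its endpoints and the apexes of its placed
triangles). [folklore] -/
def St.depsOfSide (s : St) (i : ℕ) : List ℕ :=
  let a := i / 12
  let b := i % 12
  a :: b :: s.apexes a b

/-- The labels affected by the domain changes from `s` to `s'` made by a local step at `v`
(only sides of triangles at `v` can have changed). [folklore] -/
def St.dirtyFrom (s s' : St) (v : ℕ) : List ℕ :=
  (s'.trisAt v).foldl (fun acc t =>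
    let f := fun (acc : List ℕ) (p q : ℕ) =>
      if s.gdom p q = s'.gdom p q then acc
      else (s'.depsOfSide (sIdx p q)).foldl (fun acc u => if acc.contains u then acc else u :: acc) acc
    f (f (f acc (tv0 t) (tv1 t)) (tv0 t) (tv2 t)) (tv1 t) (tv2 t)) []

/-- **Propagation** (worklist form): apply the local step at dirty labels until none is left
(at most `fuel` steps); a domain change makes the dependent labels dirty. [cite: Moore1966, §4.4] -/
def St.propagateWL (s : St) : ℕ → List ℕ → Option St
  | 0, _ => some s
  | _ + 1, [] => some s
  | fuel + 1, v :: rest =>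
    if 12 ≤ v then s.propagateWL fuel rest
    else
      match s.localStep v with
      | none => none
      | some s' =>
        let newDirty := (s.dirtyFrom s' v).filter fun u => !(rest.contains u)
        s'.propagateWL fuel (rest ++ newDirty)

/-- Propagation from scratch (every used label dirty). [folklore] -/
def St.propagate (s : St) (fuel : ℕ) : Option St :=
  s.propagateWL fuel ((List.range 12).filter fun v => s.hdeg2 v != 0)

/-- Add a triangle (rejecting duplicates and third triangles on a side). [folklore] -/
def St.addTri (s : St) (a b c : ℕ) : Option St :=
  let t := sortTri a b c
  if s.tris.contains t then none
  else
    let sc := ((s.sc.modify (sIdx a b) (· + 1)).modify (sIdx a c) (· + 1)).modify (sIdx b c) (· + 1)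
    let s' : St := ⟨s.tris.push t, s.dom, sc⟩
    if 2 < s'.gsc a b ∨ 2 < s'.gsc a c ∨ 2 < s'.gsc b c then none else some s'

/-- The contact adjacency of a state (sides with domain `0` lying in a placed triangle).
[folklore] -/
def St.adjB (s : St) (a b : ℕ) : Bool := a != b && s.gsc a b != 0 && s.gdom a b == 0

/-- `perm` (a list of `12` images) is a bijection of `Fin 12` carrying the contact graph of `s`
onto the pattern graph `tameAdjM i`. [folklore] -/
def St.isoTo (s : St) (i : Fin 8) (perm : List ℕ) : Bool :=
  perm.length == 12 &&
  (List.range 12).all (fun a => (List.range 12).all fun b => a == b || perm.getD a 12 != perm.getD b 12) &&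
  (List.range 12).all fun a => (List.range 12).all fun b =>
    if h : perm.getD a 12 < 12 ∧ perm.getD b 12 < 12 then
      s.adjB a b == tameAdjM i ⟨perm.getD a 12, h.1⟩ ⟨perm.getD b 12, h.2⟩
    else false

/-- Backtracking search for such a bijection (images of `0, 1, …` in turn). [folklore] -/
def St.findIso (s : St) (i : Fin 8) : ℕ → List ℕ → Option (List ℕ)
  | 0, _ => none
  | fuel + 1, acc =>
    let k := acc.length
    if 12 ≤ k then (if s.isoTo i acc then some acc else none)
    else
      (List.range 12).findSome? fun img =>
        if acc.contains img then none
        else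
          let ok := (List.range k).all fun a =>
            if h : acc.getD a 12 < 12 ∧ img < 12 then
              s.adjB a k == tameAdjM i ⟨acc.getD a 12, h.1⟩ ⟨img, h.2⟩
            else false
          if ok then s.findIso i fuel (acc ++ [img]) else none

/-- Accept a complete leaf: its contact graph is FCC (`tameAdjM 1`) or HCP (`tameAdjM 0`) by a
verified bijection. [cite: Hales2012, Lemma 9] -/
def St.accept (s : St) : Bool :=
  match s.findIso 1 20 [] with
  | some p => s.isoTo 1 p
  | none => match s.findIso 0 20 [] with
    | some p => s.isoTo 0 p
    | none => false

/-- The widest long side lying in a placed triangle (by number of cells), if one has `≥ 2`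
cells. [folklore] -/
def St.widest (s : St) : Option (ℕ × ℕ) :=
  (foldRange (fun (best : Option (ℕ × ℕ × ℕ)) i =>
    let a := i / 12
    let b := i % 12
    if ¬ a < b then best
    else
      let r := s.gdom a b
      if r = 0 ∨ r = UNL ∨ s.gsc a b = 0 then best
      else
        let w := rHi r - rLo r
        if w = 0 then best
        else match best with
          | none => some (w, a, b)
          | some (w', _, _) => if w' < w then some (w, a, b) else best) 0 144 none).map fun x => x.2

-- The deep fold must not be unfolded by definitional reduction when `refute` matches on it
-- (equation-lemma generation); proofs use its unfolding equation instead.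
attribute [irreducible] St.widest

/-- Refutation of a complete leaf by bisection of long-side ranges: `true` iff every sub-box is
killed by propagation. [cite: Moore1966, §4.4] -/
def St.refute (s : St) : ℕ → Bool
  | 0 => false
  | fuel + 1 =>
    match s.propagate 300 with
    | none => true
    | some s =>
      match s.widest with
      | none => false
      | some (a, b) =>
        let r := s.gdom a b
        let mid := (rLo r + rHi r) / 2
        (s.sdom a b (mkR (rLo r) mid)).refute fuel && (s.sdom a b (mkR (mid + 1) (rHi r))).refute fuel

/-- An OPEN SIDE to grow at: the smallest label `v` with an open side, the smallest `a` with
`{v, a}` in exactly one placed triangle, and the third vertex `b` of that triangle. [folklore] -/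
def St.chooseOpen (s : St) : Option (ℕ × ℕ × ℕ) :=
  (List.range 12).findSome? fun v =>
    match (List.range 12).find? fun a => a != v && s.gsc v a == 1 with
    | none => none
    | some a =>
      match s.apexes v a with
      | b :: _ => some (v, a, b)
      | [] => none

/-- The smallest unused label, if any. [folklore] -/
def St.newLabel (s : St) : Option ℕ := (List.range 12).find? fun v => s.hdeg2 v == 0

/-- Number of sides at `v` labelled long. [folklore] -/
def St.nlongAt (s : St) (v : ℕ) : ℕ :=
  foldRange (fun n u => if u ≠ v ∧ s.gdom v u ≠ 0 ∧ s.gdom v u ≠ UNL then n + 1 else n) 0 12 0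

/-- **The reflection tie-break** of the root normalisation: the label types (contact `0` /
long `1`) satisfy `(t₀₃, t₁₃) ≤ (t₀₄, t₂₄)` lexicographically; a state violating it with all
four sides labelled is killed. [folklore] -/
def St.tbKill (s : St) : Bool :=
  let d03 := s.gdom 0 3
  let d13 := s.gdom 1 3
  let d04 := s.gdom 0 4
  let d24 := s.gdom 2 4
  d03 != UNL && d13 != UNL && d04 != UNL && d24 != UNL &&
    (let t03 := if d03 = 0 then 0 else 1
     let t13 := if d13 = 0 then 0 else 1
     let t04 := if d04 = 0 then 0 else 1
     let t24 := if d24 = 0 then 0 else 1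
     decide (t04 < t03) || (t03 == t04 && decide (t24 < t13)))

/-- Counting kills after growing at `(v, a, c)`: more than `4` contacts at one of the three
labels, more than `7` long sides, more than one long side at the root label `0`, or the
tie-break. [cite: Hales2012, Lemma 7; Theorem 3 (proof)] -/
def St.countKill (s : St) (v a c : ℕ) : Bool :=
  4 < s.cdeg v || 4 < s.cdeg a || 4 < s.cdeg c || 7 < s.nlong || 1 < s.nlongAt 0 || s.tbKill

/-- The root label `0` is closed (every side at `0` lies in `0` or `2` placed triangles) but does
not show its four contacts: kill. [folklore] -/
def St.rootKill (s : St) : Bool :=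
  let (nv, ne, _, _) := s.linkSummary 0
  nv != 0 && ne == 0 && s.cdeg 0 != 4

/-- The label options of a side `{p, c}` of the new triangle in state `s`: its present label if
it has one, else the sublist of `[0 (contact), FULLR (long)]` not immediately excluded by the
counting rules (an empty list means the growth step is dead). [folklore] -/
def St.labelOpts (s : St) (p c : ℕ) : List ℕ :=
  if s.gdom p c ≠ UNL then [s.gdom p c]
  else (if s.cdeg p < 4 ∧ s.cdeg c < 4 then [0] else []) ++ (if s.nlong < 7 then [FULLR] else [])

/-- One level of the search tree: a decided leaf, or the children (states with their dirty
labels). [folklore] -/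
inductive Node
  /-- a decided node -/
  | leaf (b : Bool) : Node
  /-- an internal node -/
  | branch (kids : List (St × List ℕ)) : Node

/-- The children of a state grown at the open side `{v, a}` through the third vertex `c`:
one per admissible labelling of the new sides, minus the count-killed ones. [folklore] -/
def St.kidsAt (s : St) (v a c : ℕ) : List (St × List ℕ) :=
  match s.addTri v a c with
  | none => []
  | some s' =>
    (s.labelOpts v c).flatMap fun r1 => (s.labelOpts a c).filterMap fun r2 =>
      let s'' := (s'.sdom v c r1).sdom a c r2
      if s''.countKill v a c then none else some (s'', [v, a, c])

/-- **One level of the search.**  Propagate (dirty labels `dirty`); kill at a closed root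
without its four contacts; if no open side is left, the placed triangles must be all twenty on
all twelve labels and the leaf is accepted (FCC/HCP) or refuted by bisection; otherwise grow
at the chosen open side `{v, a}` over every third vertex `c` (an old label with room on
`{v,c}`, `{a,c}`, or the smallest new label) and every labelling of the new sides. [folklore] -/
def St.expand (s : St) (dirty : List ℕ) : Node :=
  match s.propagateWL 400 dirty with
  | none => .leaf true
  | some s =>
    if s.rootKill then .leaf true
    else
      match s.chooseOpen with
      | none =>
        .leaf (if s.tris.size != 20 || s.nused != 12 then true
          else if s.accept then true
          else s.refute 40)
      | some (v, a, b) =>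
        if 20 ≤ s.tris.size then .leaf true
        else
          .branch
            (((List.range 12).filter fun c =>
                !(c == v || c == a || c == b || s.hdeg2 c == 0 || 2 ≤ s.gsc v c || 2 ≤ s.gsc a c)).flatMap
                (fun c => s.kidsAt v a c) ++
              (match s.newLabel with
                | none => []
                | some n => s.kidsAt v a n))

/-- **The search**: `true` means every structure consistent with the state has an FCC or HCP
contact graph (`KissingSearchSearch.lean`). [folklore] -/
def St.search (s : St) (dirty : List ℕ) : ℕ → Bool
  | 0 => false
  | fuel + 1 =>
    match s.expand dirty with
    | .leaf b => b
    | .branch kids => kids.all fun p => p.1.search p.2 fuel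

/-- The empty state. [folklore] -/
def St.empty : St := ⟨#[], Array.replicate 144 UNL, Array.replicate 144 0⟩

/-- **The root states.**  Label `0` (the normalised vertex: four contacts, at most one long
side) with the triangles `{0,1,2}`, `{0,1,3}`, `{0,2,4}`, the spokes `{0,1}`, `{0,2}` contacts,
the rim `{1,2}` of type `m`, and the sides `{0,3}`, `{1,3}`, `{0,4}`, `{2,4}` of the types given
by the bits of `bits` (`0` = contact, `1` = long).  (Written with plain array updates, so that
the kernel can evaluate it.) [folklore] -/
def mkRoot (m bits : ℕ) : St :=
  let lab : ℕ → ℕ := fun t => if t = 0 then 0 else FULLR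
  let sc : Array ℕ := (((((((Array.replicate 144 0).setIfInBounds (sIdx 0 1) 2).setIfInBounds (sIdx 0 2) 2).setIfInBounds
    (sIdx 1 2) 1).setIfInBounds (sIdx 0 3) 1).setIfInBounds (sIdx 1 3) 1).setIfInBounds (sIdx 0 4) 1).setIfInBounds (sIdx 2 4) 1
  let s0 : St := ⟨#[triCode 0 1 2, triCode 0 1 3, triCode 0 2 4], Array.replicate 144 UNL, sc⟩
  ((((((s0.sdom 0 1 0).sdom 0 2 0).sdom 1 2 (lab m)).sdom 0 3 (lab (bits % 2))).sdom 1 3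
    (lab ((bits / 2) % 2))).sdom 0 4 (lab ((bits / 4) % 2))).sdom 2 4 (lab ((bits / 8) % 2))

/-- The admissible root parameters: not two long spokes, and the tie-break. [folklore] -/
def rootOK (bits : ℕ) : Bool :=
  let t03 := bits % 2
  let t13 := (bits / 2) % 2
  let t04 := (bits / 4) % 2
  let t24 := (bits / 8) % 2
  !(t03 == 1 && t04 == 1) && !(decide (t04 < t03) || (t03 == t04 && decide (t24 < t13)))

/-- **All root states** (fourteen), each with every label dirty. [folklore] -/
def rootStates : List (St × List ℕ) :=
  (List.range 2).flatMap fun m => ((List.range 16).filter rootOK).map fun bits => (mkRoot m bits, [0, 1, 2, 3, 4])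

end KissingSearch
end Summit.Ventures.Crystal3D.Kissing125
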